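import Literature.NumberTheory.CubicFields.UniformityEstimate
import Literature.NumberTheory.CubicFields.ShintaniZeta
import Mathlib.NumberTheory.LSeries.SumCoeff
import HarnessLib

/-!
# Absolute convergence of the congruence Shintani zeta functions `ξ^±(s, Φ_m)` for `Re s > 1` (from the uniformity estimate)

Topic `Literature/NumberTheory/CubicFields`; the first clause of Bhargava–Taniguchi–Thorne 2023,
Thm 2.4 ("The Shintani zeta functions `ξ^±(s, Φ_m)` converge absolutely for `ℜ(s) > 1`") for the
tree's `ShintaniZeta.shintaniZetaMod Φ sgn = LSeries (a^{sgn}(Φ, ·))`, deduced here from the tree's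
uniformity fact `btt_uniformity_sqDvd` (BTT Prop. 4.5) at `q = 1`: the number of `GL₂(ℤ)`-orbits with
`0 < ±Disc < X` is `Σ_{0<±D<X} h(D) ≤ C·X`, so for bounded `Φ` the coefficients satisfy
`Σ_{n ≤ N} |a^±(Φ, n)| ≤ B·C·(N+1)`, and Mathlib's `LSeriesSummable_of_sum_norm_bigO` gives absolute
convergence on `Re s > 1`. (Unconditionally this is Shintani 1972 / Davenport 1951's `Σ_{|D|<X} h(D) ≪ X`;
the tree proves Prop. 4.5 elsewhere, so the statements below take `(hU : btt_uniformity_sqDvd)`.)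

* `norm_shintaniCoeffMod_le` — `|a^s(Φ, n)| ≤ B · h(s·n)` for `|Φ| ≤ B`, `n ≥ 1`;
* `sum_Icc_classNumber_eq` — `Σ_{1 ≤ n ≤ N} h(s·n) = Σ_{D ∈ discWindow s (N+1)} h(D)`;
* **`lseriesSummable_shintaniCoeffMod`** — `LSeriesSummable (a^s(Φ, ·)) z` for `Re z > 1`, bounded `Φ`,
  under `btt_uniformity_sqDvd`; corollary `lseriesSummable_shintaniCoeff` (`ξ^±(s)` itself); it applies
  verbatim to the sieve weights `Φ_q = Ψ_{q²}` of §5 (`NonFundCountShintaniCoeff.psiMod`, values in `{0,1}`).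

NOT here: analytic continuation, functional equation, residues (the rest of Thm 2.4).

## References

* M. Bhargava, T. Taniguchi, F. Thorne, *Improved error estimates for the Davenport–Heilbronn
  theorems*, Math. Ann. 389 (2024) = arXiv:2107.12819, Thm 2.4 (first clause), Prop. 4.5
  [BhargavaTaniguchiThorne2023].
* T. Shintani, *On Dirichlet series whose coefficients are class numbers of integral binary cubic
  forms*, J. Math. Soc. Japan 24 (1972) (convergence for `Re s > 1`).
-/

noncomputable section

open Finset Filter Asymptotics

namespace Literature.NumberTheory.CubicFields

open BinaryCubic RingOfForm Literature.NumberTheory.QuadraticFields Classical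

/-! ### The coefficients are bounded by class numbers -/

/-- **`|a^s(Φ, n)| ≤ B · h(s·n)`** for `n ≥ 1` and `|Φ| ≤ B`: each of the `h(s·n)` orbits of
discriminant `s·n` contributes `|Φ|/|Stab| ≤ B`. [folklore] -/
theorem norm_shintaniCoeffMod_le {m : ℕ} {Φ : BinaryCubic (ZMod m) → ℂ} {B : ℝ} (hΦ : ∀ x, ‖Φ x‖ ≤ B)
    {s : ℤ} (hs : s = 1 ∨ s = -1) {n : ℕ} (hn : n ≠ 0) :
    ‖shintaniCoeffMod Φ s n‖ ≤ B * classNumber (s * n) := by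
  have hD : (s * n : ℤ) ≠ 0 := by rcases hs with rfl | rfl <;> simp [hn]
  haveI := finite_orbitsOfDisc hD
  haveI : Fintype (orbitsOfDisc (s * n)) := Fintype.ofFinite _
  have hB : 0 ≤ B := (norm_nonneg _).trans (hΦ ⟨0, 0, 0, 0⟩)
  unfold shintaniCoeffMod shintaniCoeffWith
  rw [finsum_eq_sum_of_fintype]
  calc ‖∑ O : orbitsOfDisc (s * (n : ℤ)), Φ ((orbitRep O).map (Int.castRingHom (ZMod m))) / (stabCard (orbitRep O) : ℂ)‖
      ≤ ∑ O : orbitsOfDisc (s * (n : ℤ)), ‖Φ ((orbitRep O).map (Int.castRingHom (ZMod m))) / (stabCard (orbitRep O) : ℂ)‖ :=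
        norm_sum_le _ _
    _ ≤ ∑ _O : orbitsOfDisc (s * (n : ℤ)), B := by
        refine Finset.sum_le_sum fun O _ => ?_
        rw [norm_div, Complex.norm_natCast]
        rcases Nat.eq_zero_or_pos (stabCard (orbitRep O)) with h0 | hpos
        · rw [h0, Nat.cast_zero, div_zero]; exact hB
        · rw [div_le_iff₀ (by exact_mod_cast hpos)]
          calc ‖Φ _‖ ≤ B := hΦ _
            _ = B * 1 := (mul_one B).symm
            _ ≤ B * (stabCard (orbitRep O) : ℝ) := by gcongr; exact_mod_cast hpos
    _ = B * classNumber (s * n) := by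
        rw [Finset.sum_const, Finset.card_univ, nsmul_eq_mul, mul_comm, classNumber, Nat.card_eq_fintype_card]

/-- `Σ_{1 ≤ n ≤ N} h(s·n) = Σ_{D ∈ discWindow s (N+1)} h(D)` (reindexing `D = s·n`). [folklore] -/
theorem sum_Icc_classNumber_eq {s : ℤ} (hs : s = 1 ∨ s = -1) (N : ℕ) :
    ∑ n ∈ Finset.Icc 1 N, (classNumber (s * n) : ℝ) = ∑ D ∈ discWindow s (N + 1), (classNumber D : ℝ) := by
  symm
  refine Finset.sum_bij' (fun D _ => (s * D).toNat) (fun n _ => s * (n : ℤ)) ?_ ?_ ?_ ?_ ?_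
  · intro D hD
    have h := (mem_discWindow hs).mp hD
    rw [Finset.mem_Icc]
    have h1 : ((s * D).toNat : ℤ) = s * D := Int.toNat_of_nonneg h.1.le
    constructor
    · have : (1 : ℤ) ≤ (s * D).toNat := by rw [h1]; exact h.1
      exact_mod_cast this
    · have : ((s * D).toNat : ℤ) < N + 1 := by rw [h1]; exact_mod_cast h.2
      have : ((s * D).toNat : ℤ) ≤ N := by omega
      exact_mod_cast this
  · intro n hn
    rw [Finset.mem_Icc] at hn
    rw [mem_discWindow hs]
    have hss : s * (s * (n : ℤ)) = n := by rcases hs with rfl | rfl <;> ring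
    rw [hss]
    push_cast
    exact ⟨by exact_mod_cast hn.1, by exact_mod_cast Nat.lt_succ_of_le hn.2⟩
  · intro D hD
    have h := (mem_discWindow hs).mp hD
    rw [Int.toNat_of_nonneg h.1.le]
    rcases hs with rfl | rfl <;> ring
  · intro n hn
    have hss : s * (s * (n : ℤ)) = n := by rcases hs with rfl | rfl <;> ring
    rw [hss, Int.toNat_natCast]
  · intro D hD
    have h := (mem_discWindow hs).mp hD
    have hsD : (s * ((s * D).toNat : ℤ) : ℤ) = D := by
      rw [Int.toNat_of_nonneg h.1.le]; rcases hs with rfl | rfl <;> ring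
    rw [hsD]

/-- **The number of orbits in a window is `O(X)`** under `btt_uniformity_sqDvd` (Prop. 4.5 at `q = 1`):
`Σ_{D ∈ discWindow s X} h(D) ≤ C · X`. [cite: BhargavaTaniguchiThorne2023, Proposition 4.5 (q = 1: the number of cubic rings with 0 < ±Disc < X is ≪ X)] -/
theorem exists_sum_classNumber_le (hU : btt_uniformity_sqDvd) :
    ∃ C : ℝ, ∀ s : ℤ, (s = 1 ∨ s = -1) → ∀ X : ℕ, ∑ D ∈ discWindow s X, (classNumber D : ℝ) ≤ C * X := by
  obtain ⟨C, hC⟩ := hU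
  refine ⟨C, fun s hs X => ?_⟩
  have h := hC 1 squarefree_one s hs X
  have hfilter : (discWindow s X).filter (fun D => (((1 : ℕ) : ℤ)) ^ 2 ∣ D) = discWindow s X :=
    Finset.filter_true_of_mem fun D _ => by simp
  rw [hfilter, Nat.primeFactors_one, Finset.card_empty, pow_zero, mul_one, Nat.cast_one, one_pow, div_one] at h
  exact_mod_cast h

/-! ### Absolute convergence for `Re s > 1` -/

/-- **BTT Thm 2.4, first clause (under Prop. 4.5): `ξ^s(z, Φ) = Σ_n a^s(Φ, n) n^{-z}` converges
absolutely for `Re z > 1`**, for every bounded `Φ : V(ℤ/mℤ) → ℂ` and either sign `s` — the partial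
sums of `|a^s(Φ, n)|` are `O(N)` (`norm_shintaniCoeffMod_le`, `exists_sum_classNumber_le`) and
Mathlib's `LSeriesSummable_of_sum_norm_bigO` applies. [cite: BhargavaTaniguchiThorne2023, Theorem 2.4 (absolute convergence for Re(s) > 1)] -/
theorem lseriesSummable_shintaniCoeffMod (hU : btt_uniformity_sqDvd) {m : ℕ} {Φ : BinaryCubic (ZMod m) → ℂ}
    (hΦ : ∃ B : ℝ, ∀ x, ‖Φ x‖ ≤ B) {s : ℤ} (hs : s = 1 ∨ s = -1) {z : ℂ} (hz : 1 < z.re) :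
    LSeriesSummable (shintaniCoeffMod Φ s) z := by
  obtain ⟨B, hB⟩ := hΦ
  obtain ⟨C, hC⟩ := exists_sum_classNumber_le hU
  have hB0 : 0 ≤ B := (norm_nonneg _).trans (hB ⟨0, 0, 0, 0⟩)
  refine LSeriesSummable_of_sum_norm_bigO (r := 1) ?_ zero_le_one (by simpa using hz)
  refine IsBigO.of_bound (2 * (B * max C 0)) ?_
  filter_upwards [eventually_ge_atTop 1] with N hN
  have hsum : ∑ k ∈ Finset.Icc 1 N, ‖shintaniCoeffMod Φ s k‖ ≤ B * max C 0 * (N + 1) := by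
    calc ∑ k ∈ Finset.Icc 1 N, ‖shintaniCoeffMod Φ s k‖ ≤ ∑ k ∈ Finset.Icc 1 N, B * (classNumber (s * k) : ℝ) :=
          Finset.sum_le_sum fun k hk => norm_shintaniCoeffMod_le hB hs (by have := (Finset.mem_Icc.mp hk).1; omega)
      _ = B * ∑ D ∈ discWindow s (N + 1), (classNumber D : ℝ) := by rw [← Finset.mul_sum, sum_Icc_classNumber_eq hs]
      _ ≤ B * (max C 0 * (N + 1 : ℕ)) := by
          refine mul_le_mul_of_nonneg_left ((hC s hs (N + 1)).trans ?_) hB0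
          gcongr; exact le_max_left _ _
      _ = B * max C 0 * (N + 1) := by push_cast; ring
  rw [Real.norm_of_nonneg (Finset.sum_nonneg fun _ _ => norm_nonneg _), Real.norm_of_nonneg (by positivity),
    Real.rpow_one]
  calc ∑ k ∈ Finset.Icc 1 N, ‖shintaniCoeffMod Φ s k‖ ≤ B * max C 0 * (N + 1) := hsum
    _ ≤ B * max C 0 * (2 * N) := by
        refine mul_le_mul_of_nonneg_left ?_ (by positivity)
        have : (1 : ℝ) ≤ N := by exact_mod_cast hN
        linarith
    _ = 2 * (B * max C 0) * N := by ring

/-- In particular **`ξ^±(s)` converges absolutely for `Re s > 1`** (under Prop. 4.5). [cite: BhargavaTaniguchiThorne2023, Theorem 2.4 (absolute convergence), with (11)] -/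
theorem lseriesSummable_shintaniCoeff (hU : btt_uniformity_sqDvd) {s : ℤ} (hs : s = 1 ∨ s = -1) {z : ℂ} (hz : 1 < z.re) :
    LSeriesSummable (shintaniCoeff s) z := by
  have h := lseriesSummable_shintaniCoeffMod hU (m := 1) (Φ := fun _ => (1 : ℂ)) ⟨1, fun _ => by simp⟩ hs hz
  exact h

end Literature.NumberTheory.CubicFields

end
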